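import Literature.NumberTheory.Sieve.SmoothParityMajorArcsPrep
import HarnessLib

/-!
# Parity-class friable ternary counts: tools for the major-arc summation

Topic `Literature/NumberTheory/Sieve`, namespace `Literature.NumberTheory.Sieve.SmoothArcs`; a PROVED tool file of the
circle-method engine of `SmoothParityTernary` ([Harper2016, §5]; [MontgomeryVaughanActa1975, §6] for the singular
series), collecting what the major-arc file `SmoothParityMajorArcs` needs besides the pointwise estimate and the
lattice sums.  Notation: model sums `M_i(β) = profileModelSum c_i Mv_i X_i α β`, profile sums
`V₁, V₂ = classProfileSum X_i y 2 1 c_i` (odd classes), `V₃ = classProfileSum X₃ y 1 0 c₃` (free), dilations `d₁, d₂`,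
sign `σ`, `S_i = Σ_ℓ‖c_{i,ℓ}‖(1+|ℓ|)`, `‖·‖ = distInt`.

* `norm_modelK_le`: `‖M₁(d₁u)M₂(σd₂u)M̄₃(u)‖ ≤ 100 Π(Mv_iS_i)/((1 + X₃‖u‖)(1 + X₁‖d₁u‖))`;
* `modelK_add_int`, `tripleV_add_int`: the products `K(u) = M₁(d₁u)M₂(σd₂u)M̄₃(u)` and
  `G(θ) = V₁(d₁θ)V₂(σd₂θ)V̄₃(θ)` have period `1`;
* `norm_paritySingSeries_sub_sum_le`: `‖𝔖 − Σ_{k ≤ R} paritySingTerm k‖ ≤ 3(d₁d₂)^α e^{2420(1−α)/(3α−13/5−δ)}(R+1)^{−δ}`,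
  `δ = (3α − 13/5)/2`;
* small real inequalities for the collection: `prod_three_mono`, `flat_level_le` (the flat error at level `k` against
  `Π(1+Hc_i)` and `ΠHc_i`), `decay_three_le_two` (keep two of the three decaying factors), `lattice_factor_le`,
  `flat_w_mono`, `norm_LF_triple_le`, `norm_parityModelCount_le'`, `eleven_mul_le`.

## References

* A. J. Harper, Compositio Math. 152 (2016), §5 [Harper2016].
* H. L. Montgomery, R. C. Vaughan, Acta Arith. 27 (1975), §6 [MontgomeryVaughanActa1975].
-/

noncomputable section

open Finset Real Complex
open scoped FourierTransform

namespace Literature.NumberTheory.Sieve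

namespace SmoothArcs

open Vinogradov

/-! ### The model product and the profile product: decay and periodicity -/

/-- **Decay of the model product**: `‖M₁(d₁u) M₂(σd₂u) conj M₃(u)‖ ≤ 100 Π(Mv_iS_i)/((1 + X₃‖u‖)(1 + X₁‖d₁u‖))`
(`Mv_i ≥ 0`, `X₁, X₃ ≥ 1`, `X₂ > 0`, `0 ≤ α ≤ 1`; `norm_profileModelSum_le_div_one_add_distInt` for `M₁, M₃` and the
trivial bound for `M₂`). [cite: Harper2016, §5] -/
theorem norm_modelK_le {c₁ c₂ c₃ : ℤ → ℂ} (hc₁ : Summable (fun ℓ : ℤ => ‖c₁ ℓ‖ * (1 + |(ℓ : ℝ)|) ^ 3))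
    (hc₂ : Summable (fun ℓ : ℤ => ‖c₂ ℓ‖ * (1 + |(ℓ : ℝ)|) ^ 3)) (hc₃ : Summable (fun ℓ : ℤ => ‖c₃ ℓ‖ * (1 + |(ℓ : ℝ)|) ^ 3))
    {Mv₁ Mv₂ Mv₃ X₁ X₂ X₃ α : ℝ} (hMv₁ : 0 ≤ Mv₁) (hMv₂ : 0 ≤ Mv₂) (hMv₃ : 0 ≤ Mv₃) (hX₁ : 1 ≤ X₁) (hX₂ : 0 < X₂)
    (hX₃ : 1 ≤ X₃) (hα0 : 0 ≤ α) (hα1 : α ≤ 1) (d₁ d₂ : ℕ) (σ : ℤ) (u : ℝ) :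
    ‖profileModelSum c₁ Mv₁ X₁ α ((d₁ : ℝ) * u) * profileModelSum c₂ Mv₂ X₂ α ((σ : ℝ) * d₂ * u) *
        starRingEnd ℂ (profileModelSum c₃ Mv₃ X₃ α u)‖ ≤
      100 * ((Mv₁ * ∑' ℓ : ℤ, ‖c₁ ℓ‖ * (1 + |(ℓ : ℝ)|)) * (Mv₂ * ∑' ℓ : ℤ, ‖c₂ ℓ‖ * (1 + |(ℓ : ℝ)|)) *
        (Mv₃ * ∑' ℓ : ℤ, ‖c₃ ℓ‖ * (1 + |(ℓ : ℝ)|))) /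
        ((1 + X₃ * distInt u) * (1 + X₁ * distInt ((d₁ : ℝ) * u))) := by
  set S₁ := ∑' ℓ : ℤ, ‖c₁ ℓ‖ * (1 + |(ℓ : ℝ)|) with hS₁
  set S₂ := ∑' ℓ : ℤ, ‖c₂ ℓ‖ * (1 + |(ℓ : ℝ)|) with hS₂
  set S₃ := ∑' ℓ : ℤ, ‖c₃ ℓ‖ * (1 + |(ℓ : ℝ)|) with hS₃
  have hS₁0 : 0 ≤ S₁ := tsum_nonneg fun ℓ => by positivity
  have hS₂0 : 0 ≤ S₂ := tsum_nonneg fun ℓ => by positivity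
  have hS₃0 : 0 ≤ S₃ := tsum_nonneg fun ℓ => by positivity
  have hδ₁ := distInt_nonneg ((d₁ : ℝ) * u)
  have hδ₃ := distInt_nonneg u
  have h1 := norm_profileModelSum_le_div_one_add_distInt (summable_norm_mul_of_cube hc₁) hMv₁ hX₁ hα0 hα1
    ((d₁ : ℝ) * u) (c := c₁)
  have h2 : ‖profileModelSum c₂ Mv₂ X₂ α ((σ : ℝ) * d₂ * u)‖ ≤ Mv₂ * S₂ :=
    (norm_profileModelSum_le (summable_norm_of_cube hc₂) hMv₂ hX₂ hα0 _).trans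
      (mul_le_mul_of_nonneg_left (tsum_norm_le_tsum_norm_mul (summable_norm_mul_of_cube hc₂)) hMv₂)
  have h3 := norm_profileModelSum_le_div_one_add_distInt (summable_norm_mul_of_cube hc₃) hMv₃ hX₃ hα0 hα1 u (c := c₃)
  rw [← hS₁] at h1
  rw [← hS₃] at h3
  rw [norm_mul, norm_mul, Complex.norm_conj]
  have hd₁ : 0 < 1 + X₁ * distInt ((d₁ : ℝ) * u) := by positivity
  have hd₃ : 0 < 1 + X₃ * distInt u := by positivity
  calc ‖profileModelSum c₁ Mv₁ X₁ α ((d₁ : ℝ) * u)‖ * ‖profileModelSum c₂ Mv₂ X₂ α ((σ : ℝ) * d₂ * u)‖ *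
        ‖profileModelSum c₃ Mv₃ X₃ α u‖
      ≤ (10 * Mv₁ * S₁ / (1 + X₁ * distInt ((d₁ : ℝ) * u))) * (Mv₂ * S₂) * (10 * Mv₃ * S₃ / (1 + X₃ * distInt u)) :=
        mul_le_mul (mul_le_mul h1 h2 (norm_nonneg _) (by positivity)) h3 (norm_nonneg _) (by positivity)
    _ = 100 * ((Mv₁ * S₁) * (Mv₂ * S₂) * (Mv₃ * S₃)) / ((1 + X₃ * distInt u) * (1 + X₁ * distInt ((d₁ : ℝ) * u))) := by
        field_simp
        ring

/-- The model product `K(u) = M₁(d₁u) M₂(σd₂u) conj M₃(u)` has period `1`. [folklore] -/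
theorem modelK_add_int (c₁ c₂ c₃ : ℤ → ℂ) (Mv₁ Mv₂ Mv₃ X₁ X₂ X₃ α : ℝ) (d₁ d₂ : ℕ) (σ : ℤ) (u : ℝ) (n : ℤ) :
    profileModelSum c₁ Mv₁ X₁ α ((d₁ : ℝ) * (u + n)) * profileModelSum c₂ Mv₂ X₂ α ((σ : ℝ) * d₂ * (u + n)) *
        starRingEnd ℂ (profileModelSum c₃ Mv₃ X₃ α (u + n)) =
      profileModelSum c₁ Mv₁ X₁ α ((d₁ : ℝ) * u) * profileModelSum c₂ Mv₂ X₂ α ((σ : ℝ) * d₂ * u) *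
        starRingEnd ℂ (profileModelSum c₃ Mv₃ X₃ α u) := by
  have e1 : (d₁ : ℝ) * (u + n) = (d₁ : ℝ) * u + ((d₁ * n : ℤ) : ℝ) := by push_cast; ring
  have e2 : (σ : ℝ) * d₂ * (u + n) = (σ : ℝ) * d₂ * u + ((σ * d₂ * n : ℤ) : ℝ) := by push_cast; ring
  rw [e1, e2, profileModelSum_add_int, profileModelSum_add_int, profileModelSum_add_int]

/-- The profile product `G(θ) = V₁(d₁θ) V₂(σd₂θ) conj V₃(θ)` has period `1`. [folklore] -/
theorem tripleV_add_int (X₁ X₂ X₃ : ℝ) (y : ℕ) (c₁ c₂ c₃ : ℤ → ℂ) (d₁ d₂ : ℕ) (σ : ℤ) (θ : ℝ) (n : ℤ) :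
    classProfileSum X₁ y 2 1 c₁ ((d₁ : ℝ) * (θ + n)) * classProfileSum X₂ y 2 1 c₂ ((σ : ℝ) * d₂ * (θ + n)) *
        starRingEnd ℂ (classProfileSum X₃ y 1 0 c₃ (θ + n)) =
      classProfileSum X₁ y 2 1 c₁ ((d₁ : ℝ) * θ) * classProfileSum X₂ y 2 1 c₂ ((σ : ℝ) * d₂ * θ) *
        starRingEnd ℂ (classProfileSum X₃ y 1 0 c₃ θ) := by
  have e1 : (d₁ : ℝ) * (θ + n) = (d₁ : ℝ) * θ + ((d₁ * n : ℤ) : ℝ) := by push_cast; ring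
  have e2 : (σ : ℝ) * d₂ * (θ + n) = (σ : ℝ) * d₂ * θ + ((σ * d₂ * n : ℤ) : ℝ) := by push_cast; ring
  rw [e1, e2, classProfileSum_add_int, classProfileSum_add_int, classProfileSum_add_int]

/-! ### The singular series truncated at `R` -/

/-- **Truncating the singular series**: for `13/15 < α ≤ 1`, `σ = ±1`, `d₁ ≥ 1` even, `d₂` odd and every `R`,
`‖𝔖 − Σ_{1 ≤ k ≤ R} paritySingTerm k‖ ≤ 3 (d₁d₂)^α exp(2420(1−α)/(3α−13/5−δ)) (R+1)^{−δ}`, `δ = (3α − 13/5)/2`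
(`paritySingTerm 0 = 0`; `tsum_norm_paritySingTerm_add_le`). [cite: MontgomeryVaughanActa1975, §6] -/
theorem norm_paritySingSeries_sub_sum_le {α : ℝ} (hα : 13 / 15 < α) (hα1 : α ≤ 1) {σ : ℤ} (hσ : σ = 1 ∨ σ = -1)
    {d₁ d₂ : ℕ} (hd₁ : d₁ ≠ 0) (hd₁e : Even d₁) (hd₂ : Odd d₂) (R : ℕ) :
    ‖paritySingSeries α σ d₁ d₂ - ∑ k ∈ Icc 1 R, paritySingTerm α σ d₁ d₂ k‖ ≤
      3 * ((d₁ * d₂ : ℕ) : ℝ) ^ α * Real.exp (2420 * (1 - α) / (3 * α - 13 / 5 - (3 * α - 13 / 5) / 2)) *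
        ((R + 1 : ℕ) : ℝ) ^ (-((3 * α - 13 / 5) / 2)) := by
  obtain ⟨hsum, -⟩ := summable_norm_paritySingTerm hα hα1 hσ hd₁ hd₁e hd₂
  have hs : Summable (paritySingTerm α σ d₁ d₂) := hsum.of_norm
  have hsplit := hs.sum_add_tsum_nat_add (R + 1)
  have h0 : ∑ k ∈ Finset.range (R + 1), paritySingTerm α σ d₁ d₂ k = ∑ k ∈ Icc 1 R, paritySingTerm α σ d₁ d₂ k := by
    rw [Finset.range_eq_Ico, Finset.sum_eq_sum_Ico_succ_bot (Nat.succ_pos R)]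
    have : paritySingTerm α σ d₁ d₂ 0 = 0 := by
      unfold paritySingTerm; rw [Finset.range_zero, Finset.filter_empty, Finset.sum_empty]
    rw [this, zero_add, zero_add, Nat.succ_eq_add_one, Finset.Ico_add_one_right_eq_Icc]
  have e : paritySingSeries α σ d₁ d₂ - ∑ k ∈ Icc 1 R, paritySingTerm α σ d₁ d₂ k =
      ∑' k : ℕ, paritySingTerm α σ d₁ d₂ (k + (R + 1)) := by
    rw [paritySingSeries, ← hsplit, h0, add_sub_cancel_left]
  rw [e]
  have hδ0 : 0 < (3 * α - 13 / 5) / 2 := by linarith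
  have hδ : (3 * α - 13 / 5) / 2 < 3 * α - 13 / 5 := by linarith
  have hsR : Summable (fun k : ℕ => ‖paritySingTerm α σ d₁ d₂ (k + (R + 1))‖) :=
    (summable_nat_add_iff (f := fun k : ℕ => ‖paritySingTerm α σ d₁ d₂ k‖) (R + 1)).mpr hsum
  refine (norm_tsum_le_tsum_norm hsR).trans ?_
  exact tsum_norm_paritySingTerm_add_le hα hα1 hδ0 hδ hσ hd₁ hd₁e hd₂ (Nat.succ_ne_zero R)


/-! ### Small inequalities for the collection of the major arcs -/

/-- Monotonicity of a triple product in its additive parts. [folklore] -/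
theorem prod_three_mono {p₁ p₂ p₃ w₁ w₂ w₃ W₁ W₂ W₃ : ℝ} (hp₁ : 0 ≤ p₁) (hp₂ : 0 ≤ p₂) (hp₃ : 0 ≤ p₃) (hw₁ : 0 ≤ w₁)
    (hw₂ : 0 ≤ w₂) (hw₃ : 0 ≤ w₃) (h₁ : w₁ ≤ W₁) (h₂ : w₂ ≤ W₂) (h₃ : w₃ ≤ W₃) :
    (p₁ + w₁) * (p₂ + w₂) * (p₃ + w₃) ≤ (p₁ + W₁) * (p₂ + W₂) * (p₃ + W₃) :=
  mul_le_mul (mul_le_mul (by linarith) (by linarith) (by positivity) (by linarith)) (by linarith) (by positivity)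
    (mul_nonneg (by linarith) (by linarith))

/-- **The flat error at level `k` against the two arithmetic sums.**  With `b_i = Mv_i(11S_i + u_i)`, `wk_i ≤ w_i`:
`Π(11Hc_iMv_iS_i + Hc_iMv_iu_i + wk_i) − Π 11Hc_iMv_iS_i ≤ Π(1+Hc_i)·(Π(b_i+w_i) − Πb_i) + ΠHc_i·(Πb_i − Π 11Mv_iS_i)`
(`prod_three_mono`, `prod_three_flat_le`). [folklore] -/
theorem flat_level_le {Hc₁ Hc₂ Hc₃ Mv₁ Mv₂ Mv₃ S₁ S₂ S₃ u₁ u₂ u₃ wk₁ wk₂ wk₃ w₁ w₂ w₃ : ℝ} (hHc₁ : 0 ≤ Hc₁)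
    (hHc₂ : 0 ≤ Hc₂) (hHc₃ : 0 ≤ Hc₃) (hMv₁ : 0 ≤ Mv₁) (hMv₂ : 0 ≤ Mv₂) (hMv₃ : 0 ≤ Mv₃) (hS₁ : 0 ≤ S₁) (hS₂ : 0 ≤ S₂)
    (hS₃ : 0 ≤ S₃) (hu₁ : 0 ≤ u₁) (hu₂ : 0 ≤ u₂) (hu₃ : 0 ≤ u₃) (hwk₁ : 0 ≤ wk₁) (hwk₂ : 0 ≤ wk₂) (hwk₃ : 0 ≤ wk₃)
    (h₁ : wk₁ ≤ w₁) (h₂ : wk₂ ≤ w₂) (h₃ : wk₃ ≤ w₃) :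
    (11 * (Hc₁ * (Mv₁ * S₁)) + (Hc₁ * Mv₁ * u₁ + wk₁)) * (11 * (Hc₂ * (Mv₂ * S₂)) + (Hc₂ * Mv₂ * u₂ + wk₂)) *
        (11 * (Hc₃ * (Mv₃ * S₃)) + (Hc₃ * Mv₃ * u₃ + wk₃)) -
        11 * (Hc₁ * (Mv₁ * S₁)) * (11 * (Hc₂ * (Mv₂ * S₂))) * (11 * (Hc₃ * (Mv₃ * S₃))) ≤
      (1 + Hc₁) * (1 + Hc₂) * (1 + Hc₃) *
          ((Mv₁ * (11 * S₁ + u₁) + w₁) * (Mv₂ * (11 * S₂ + u₂) + w₂) * (Mv₃ * (11 * S₃ + u₃) + w₃) -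
            Mv₁ * (11 * S₁ + u₁) * (Mv₂ * (11 * S₂ + u₂)) * (Mv₃ * (11 * S₃ + u₃))) +
        Hc₁ * Hc₂ * Hc₃ * (Mv₁ * (11 * S₁ + u₁) * (Mv₂ * (11 * S₂ + u₂)) * (Mv₃ * (11 * S₃ + u₃)) -
          11 * (Mv₁ * S₁) * (11 * (Mv₂ * S₂)) * (11 * (Mv₃ * S₃))) := by
  have e1 : ∀ (Hc Mv S u wk : ℝ), 11 * (Hc * (Mv * S)) + (Hc * Mv * u + wk) = Hc * (Mv * (11 * S + u)) + wk :=
    fun _ _ _ _ _ => by ring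
  have e2 : 11 * (Hc₁ * (Mv₁ * S₁)) * (11 * (Hc₂ * (Mv₂ * S₂))) * (11 * (Hc₃ * (Mv₃ * S₃))) =
      Hc₁ * (11 * (Mv₁ * S₁)) * (Hc₂ * (11 * (Mv₂ * S₂))) * (Hc₃ * (11 * (Mv₃ * S₃))) := by ring
  rw [e1, e1, e1, e2]
  have hb₁ : 11 * (Mv₁ * S₁) ≤ Mv₁ * (11 * S₁ + u₁) := by nlinarith [mul_nonneg hMv₁ hu₁]
  have hb₂ : 11 * (Mv₂ * S₂) ≤ Mv₂ * (11 * S₂ + u₂) := by nlinarith [mul_nonneg hMv₂ hu₂]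
  have hb₃ : 11 * (Mv₃ * S₃) ≤ Mv₃ * (11 * S₃ + u₃) := by nlinarith [mul_nonneg hMv₃ hu₃]
  have hmono := prod_three_mono (mul_nonneg hHc₁ (le_trans (by positivity) hb₁)) (mul_nonneg hHc₂ (le_trans (by positivity) hb₂))
    (mul_nonneg hHc₃ (le_trans (by positivity) hb₃)) hwk₁ hwk₂ hwk₃ h₁ h₂ h₃
  have hfl := prod_three_flat_le hHc₁ hHc₂ hHc₃ (by positivity : (0 : ℝ) ≤ 11 * (Mv₁ * S₁))
    (by positivity : (0 : ℝ) ≤ 11 * (Mv₂ * S₂)) (by positivity : (0 : ℝ) ≤ 11 * (Mv₃ * S₃)) hb₁ hb₂ hb₃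
    (hwk₁.trans h₁) (hwk₂.trans h₂) (hwk₃.trans h₃)
  linarith

/-- **Two of the three decaying factors.**  For `X₁, X₃ > 0`, any `d₁ d₂ X₂` and `β`:
`Π_i 1/(1+|λ_i|) ≤ 1/((1 + max(X₃, d₁X₁)|β|)(1 + min(X₃, d₁X₁)|β|))`, `λ₁ = d₁βX₁`, `λ₂ = d₂βX₂`, `λ₃ = βX₃`. [folklore] -/
theorem decay_three_le_two {X₁ X₂ X₃ β : ℝ} (hX₁ : 0 < X₁) (hX₃ : 0 < X₃) (d₁ d₂ : ℕ) :
    1 / (1 + |(d₁ : ℝ) * β * X₁|) * (1 / (1 + |(d₂ : ℝ) * β * X₂|)) * (1 / (1 + |β * X₃|)) ≤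
      1 / ((1 + max X₃ ((d₁ : ℝ) * X₁) * |β|) * (1 + min X₃ ((d₁ : ℝ) * X₁) * |β|)) := by
  have e1 : |(d₁ : ℝ) * β * X₁| = (d₁ : ℝ) * X₁ * |β| := by
    rw [abs_mul, abs_mul, abs_of_nonneg (Nat.cast_nonneg d₁), abs_of_pos hX₁]; ring
  have e3 : |β * X₃| = X₃ * |β| := by rw [abs_mul, abs_of_pos hX₃]; ring
  have hβ0 := abs_nonneg β
  have ht₂ : 1 / (1 + |(d₂ : ℝ) * β * X₂|) ≤ 1 := by
    rw [div_le_one (by positivity)]; linarith [abs_nonneg ((d₂ : ℝ) * β * X₂)]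
  have hprod : (1 + max X₃ ((d₁ : ℝ) * X₁) * |β|) * (1 + min X₃ ((d₁ : ℝ) * X₁) * |β|) =
      (1 + X₃ * |β|) * (1 + (d₁ : ℝ) * X₁ * |β|) := by
    rcases le_total X₃ ((d₁ : ℝ) * X₁) with h1 | h1
    · rw [max_eq_right h1, min_eq_left h1]; ring
    · rw [max_eq_left h1, min_eq_right h1]
  rw [hprod, e1, e3]
  have hd : 0 ≤ (d₁ : ℝ) * X₁ * |β| := by positivity
  calc 1 / (1 + (d₁ : ℝ) * X₁ * |β|) * (1 / (1 + |(d₂ : ℝ) * β * X₂|)) * (1 / (1 + X₃ * |β|))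
      ≤ 1 / (1 + (d₁ : ℝ) * X₁ * |β|) * 1 * (1 / (1 + X₃ * |β|)) :=
        mul_le_mul_of_nonneg_right (mul_le_mul_of_nonneg_left ht₂ (by positivity)) (by positivity)
    _ = 1 / ((1 + X₃ * |β|) * (1 + (d₁ : ℝ) * X₁ * |β|)) := by rw [mul_one, one_div_mul_one_div, mul_comm]

/-- **The lattice factor is symmetric in the two rates**: with `A = max(X₃, d₁X₁)`, `B = min(X₃, d₁X₁)`,
`4(1 + (N₀/A)(3 + |log(B/N₀)|)) ≤ 4(1 + (N₀/X₃)(3 + |log(X₃/N₀)| + |log(d₁X₁/N₀)|))`. [folklore] -/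
theorem lattice_factor_le {X₁ X₃ N₀ : ℝ} (hX₁ : 0 < X₁) (hX₃ : 0 < X₃) (hN : 0 ≤ N₀) {d₁ : ℕ} (hd₁ : 1 ≤ d₁) :
    4 * (1 + N₀ / max X₃ ((d₁ : ℝ) * X₁) * (3 + |Real.log (min X₃ ((d₁ : ℝ) * X₁) / N₀)|)) ≤
      4 * (1 + N₀ / X₃ * (3 + |Real.log (X₃ / N₀)| + |Real.log ((d₁ : ℝ) * X₁ / N₀)|)) := by
  have hd1 : (1 : ℝ) ≤ d₁ := by exact_mod_cast hd₁
  have hd : 0 < (d₁ : ℝ) * X₁ := by positivity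
  have h1 : N₀ / max X₃ ((d₁ : ℝ) * X₁) ≤ N₀ / X₃ := div_le_div_of_nonneg_left hN hX₃ (le_max_left _ _)
  have h2 : |Real.log (min X₃ ((d₁ : ℝ) * X₁) / N₀)| ≤ |Real.log (X₃ / N₀)| + |Real.log ((d₁ : ℝ) * X₁ / N₀)| := by
    rcases min_choice X₃ ((d₁ : ℝ) * X₁) with h | h
    · rw [h]; linarith [abs_nonneg (Real.log ((d₁ : ℝ) * X₁ / N₀))]
    · rw [h]; linarith [abs_nonneg (Real.log (X₃ / N₀))]
  have h3 : 0 ≤ 3 + |Real.log (min X₃ ((d₁ : ℝ) * X₁) / N₀)| := by positivity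
  have h4 : 0 ≤ N₀ / X₃ := by positivity
  nlinarith [mul_le_mul h1 (by linarith [h2] : 3 + |Real.log (min X₃ ((d₁ : ℝ) * X₁) / N₀)| ≤
    3 + |Real.log (X₃ / N₀)| + |Real.log ((d₁ : ℝ) * X₁ / N₀)|) h3 h4]

/-- The `k`-dependent part of the flat error is increasing in `k`. [folklore] -/
theorem flat_w_mono {k R C Xp ε₀ Λ cd pN : ℝ} (hk : 0 ≤ k) (hkR : k ≤ R) (hC : 0 ≤ C) (hXp : 0 ≤ Xp) (hε₀ : 0 ≤ ε₀)
    (hΛ : 0 ≤ 1 + Λ) (hpN : 0 ≤ pN) :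
    (2 * k * C * Xp * (2 * k) ^ ε₀ * (1 + Λ) ^ 3 + cd) * pN ≤ (2 * R * C * Xp * (2 * R) ^ ε₀ * (1 + Λ) ^ 3 + cd) * pN := by
  have h2k : 2 * k ≤ 2 * R := by linarith
  have hR0 : 0 ≤ R := hk.trans hkR
  refine mul_le_mul_of_nonneg_right (add_le_add ?_ le_rfl) hpN
  exact mul_le_mul_of_nonneg_right (mul_le_mul (mul_le_mul_of_nonneg_right (mul_le_mul_of_nonneg_right h2k hC) hXp)
    (Real.rpow_le_rpow (by positivity) h2k hε₀) (by positivity) (by positivity)) (pow_nonneg hΛ 3)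


/-- `‖LF₁ LF₂ conj LF₃‖ ≤ Hc₁ Hc₂ Hc₃` for the class local factors and their cancelling majorants (`α ≥ 0`). [folklore] -/
theorem norm_LF_triple_le {α : ℝ} (hα : 0 ≤ α) (k : ℕ) (h₁ h₂ h₃ : ℤ) :
    ‖classLocalFactor α 2 1 k h₁ * classLocalFactor α 2 1 k h₂ * starRingEnd ℂ (classLocalFactor α 1 0 k h₃)‖ ≤
      classLocalHc α 2 1 k h₁ * classLocalHc α 2 1 k h₂ * classLocalHc α 1 0 k h₃ := by
  rw [norm_mul, norm_mul, Complex.norm_conj]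
  exact mul_le_mul (mul_le_mul (norm_classLocalFactor_le hα 2 1 k _) (norm_classLocalFactor_le hα 2 1 k _)
    (norm_nonneg _) (classLocalHc_nonneg α 2 1 k _)) (norm_classLocalFactor_le hα 1 0 k _) (norm_nonneg _)
    (mul_nonneg (classLocalHc_nonneg α 2 1 k _) (classLocalHc_nonneg α 2 1 k _))

/-- `‖parityModelCount‖ ≤ Π(Mv_iS_i)/X₃` with `S_i = Σ_ℓ‖c_{i,ℓ}‖(1+|ℓ|)` (`norm_parityModelCount_le` and `Σ‖c‖ ≤ S`).
[cite: Harper2016, §5] -/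
theorem norm_parityModelCount_le' {c₁ c₂ c₃ : ℤ → ℂ} (hc₁ : Summable (fun ℓ : ℤ => ‖c₁ ℓ‖ * (1 + |(ℓ : ℝ)|) ^ 3))
    (hc₂ : Summable (fun ℓ : ℤ => ‖c₂ ℓ‖ * (1 + |(ℓ : ℝ)|) ^ 3)) (hc₃ : Summable (fun ℓ : ℤ => ‖c₃ ℓ‖ * (1 + |(ℓ : ℝ)|) ^ 3))
    (σ : ℤ) (d₁ d₂ : ℕ) {X₁ X₂ X₃ Mv₁ Mv₂ Mv₃ α : ℝ} (hX₁ : 0 < X₁) (hX₂ : 0 < X₂) (hX₃ : 0 < X₃) (hMv₁ : 0 ≤ Mv₁)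
    (hMv₂ : 0 ≤ Mv₂) (hMv₃ : 0 ≤ Mv₃) (hα : 0 ≤ α) :
    ‖parityModelCount σ d₁ d₂ X₁ X₂ X₃ Mv₁ Mv₂ Mv₃ α c₁ c₂ c₃‖ ≤
      (Mv₁ * ∑' ℓ : ℤ, ‖c₁ ℓ‖ * (1 + |(ℓ : ℝ)|)) * (Mv₂ * ∑' ℓ : ℤ, ‖c₂ ℓ‖ * (1 + |(ℓ : ℝ)|)) *
        (Mv₃ * ∑' ℓ : ℤ, ‖c₃ ℓ‖ * (1 + |(ℓ : ℝ)|)) / X₃ := by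
  refine (norm_parityModelCount_le (summable_norm_of_cube hc₁) (summable_norm_of_cube hc₂) (summable_norm_of_cube hc₃)
    σ d₁ d₂ hX₁ hX₂ hX₃ hMv₁ hMv₂ hMv₃ hα).trans (div_le_div_of_nonneg_right ?_ hX₃.le)
  have h0 : ∀ c : ℤ → ℂ, 0 ≤ ∑' ℓ : ℤ, ‖c ℓ‖ := fun c => tsum_nonneg fun _ => norm_nonneg _
  exact mul_le_mul (mul_le_mul (mul_le_mul_of_nonneg_left (tsum_norm_le_tsum_norm_mul (summable_norm_mul_of_cube hc₁)) hMv₁)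
    (mul_le_mul_of_nonneg_left (tsum_norm_le_tsum_norm_mul (summable_norm_mul_of_cube hc₂)) hMv₂)
    (mul_nonneg hMv₂ (h0 c₂)) (by positivity))
    (mul_le_mul_of_nonneg_left (tsum_norm_le_tsum_norm_mul (summable_norm_mul_of_cube hc₃)) hMv₃)
    (mul_nonneg hMv₃ (h0 c₃)) (by positivity)

/-- `11·(Mv S) ≤ Mv(11S + u)` for `Mv, u ≥ 0`. [folklore] -/
theorem eleven_mul_le {Mv S u : ℝ} (hMv : 0 ≤ Mv) (hu : 0 ≤ u) : 11 * (Mv * S) ≤ Mv * (11 * S + u) := by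
  nlinarith [mul_nonneg hMv hu]

end SmoothArcs

end Literature.NumberTheory.Sieve

end
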